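import Summits.KontsevichZagierPeriods.Zeta5Search.Certificates.VIML3Defs
import Summits.KontsevichZagierPeriods.Zeta5Search.Certificates.ModRedLNKData1
import HarnessLib

/-!
# ζ(5) search — brown9 LEVEL 3: the (L-NK) coefficient data of the two certifier seats agree (cell `pub-zeta5`, certifier `cert-1`)

HONEST FRAMING: systematic search; recurrence certificates; no irrationality claim unless certified.

Preparation of the last bridge: cert-2's dense data `etaM10, etaM00, etaM01, etaM02` (`ModRedLNKData1`, the lane's (L-NK)
telescoper ×12) evaluate to the polynomials `muQ10, muQ00, muQ01, muQ02` of the level-3 input predicate `LNKAt`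
(`VIML3Defs`, same ×12). When cert-2's all-`x` theorem for (L-NK) lands (their `ModRedLNK*` line), `LNKAt_holds` is the
four-line analogue of `VIML3BridgeK3.LK3At_holds`, and `VIML3Final.vimLeadingRecurrence_of_LNK` becomes unconditional.
No named facts.
-/

namespace Summit.KontsevichZagierPeriods.Zeta5Search.Certificates

namespace VIMInner.L3

open Summit.KontsevichZagierPeriods.Zeta5Search.PolyReflect

/-- `etaM10` (cert-2) evaluates to `muQ10` (cert-1). -/
theorem etaM10_muQ10 (w x : ℚ) : ev2 ModRed.etaM10 w x = muQ10 w x := by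
  simp [ModRed.etaM10, ev2, ev1, muQ10]; ring

/-- `etaM00` evaluates to `muQ00`. -/
theorem etaM00_muQ00 (w x : ℚ) : ev2 ModRed.etaM00 w x = muQ00 w x := by
  simp [ModRed.etaM00, ev2, ev1, muQ00]; ring

/-- `etaM01` evaluates to `muQ01`. -/
theorem etaM01_muQ01 (w x : ℚ) : ev2 ModRed.etaM01 w x = muQ01 w x := by
  simp [ModRed.etaM01, ev2, ev1, muQ01]; ring

/-- `etaM02` evaluates to `muQ02`. -/
theorem etaM02_muQ02 (w x : ℚ) : ev2 ModRed.etaM02 w x = muQ02 w x := by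
  simp [ModRed.etaM02, ev2, ev1, muQ02]; ring

end VIMInner.L3

end Summit.KontsevichZagierPeriods.Zeta5Search.Certificates
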